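import Mathlib
import Literature.NumberTheory.Transcendental.KZLogCalculusProofs
import Literature.NumberTheory.Transcendental.KZRelationsLE
import Literature.NumberTheory.Transcendental.KZSemialgebraicComplex
import Literature.NumberTheory.Transcendental.KZDominatedFamilyRelations
import Literature.NumberTheory.Transcendental.KZIntervalPeriodProofs
import Literature.NumberTheory.Transcendental.SemialgebraicLineDeriv
import Summits.KontsevichZagierPeriods.KontsevichZagierPeriods.Theses.InverseLandau
import Summits.KontsevichZagierPeriods.KontsevichZagierPeriods.Theorems.LogPrimitiveNL.Negative.DimZero
import Summits.KontsevichZagierPeriods.KontsevichZagierPeriods.Theorems.LogPrimitiveNL.Negative.BakerRelationSpan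
import Summits.KontsevichZagierPeriods.KontsevichZagierPeriods.Theorems.LiouvilleUnfoldingLogPrimitiveNL
import Summits.KontsevichZagierPeriods.KontsevichZagierPeriods.Theorems.TerasomaMultiplicationBetaCancellationStubMoebiusMove
import Summits.KontsevichZagierPeriods.KontsevichZagierPeriods.Theorems.InverseLandauTateFamilyKernelCurvesStubComplexPartialFractions
import Summits.KontsevichZagierPeriods.KontsevichZagierPeriods.Theorems.InverseLandauTateFamilyKernelCurvesStubRealPart
import Summits.KontsevichZagierPeriods.KontsevichZagierPeriods.Theorems.InverseLandauTateFamilyKernelCurvesStubBakerSplitting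
import Summits.KontsevichZagierPeriods.KontsevichZagierPeriods.Theorems.InverseLandauTateFamilyKernelCurvesStubExactModulusPart
import Summits.KontsevichZagierPeriods.KontsevichZagierPeriods.Theorems.InverseLandauTateFamilyKernelCurvesStubAnglePartToArcs
import Summits.KontsevichZagierPeriods.KontsevichZagierPeriods.Theorems.InverseLandauTateFamilyKernelCurvesStubArcScissors
import Summits.KontsevichZagierPeriods.KontsevichZagierPeriods.Theorems.InverseLandauTateFamilyKernelCurvesStubArcNormalization

/-!
# `TateFamilyKernelCurves` (stmt-KontsevichZagierPeriods-9132) — line `Sketch` (Baker at the fibre)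

MAIN FILE of the line (lead prover; the seven stubs are landed as
`Theorems/InverseLandauTateFamilyKernelCurvesStub*.lean` and imported here). The crux
(`Summit.KontsevichZagierPeriods.KontsevichZagierPeriods.Theses.InverseLandau.TateFamilyKernelCurves`,
proved below as `TateFamilyKernelCurves_of`, no named facts assumed): for a Tate family
`P/Q ∈ ℚ[z][ϖ]` admissible on `(0,ε)` whose fibre integrals `∫₀¹ P/Q(z,ϖ) dz` vanish on `(0,ε)`, the fibre `[(0,1), P/Q(·,ϖ₀)]` at a
real-algebraic `ϖ₀ ∈ (0,ε)` is a relation of the Kontsevich–Zagier calculus.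

Line: TRANSFER `C⁺` (`algCoeffKernelDimOne`): a real rational integrand `p/q` with REAL ALGEBRAIC
coefficients, `q ≠ 0` on `[0,1]`, `∫₀¹ p/q = 0`, gives a relation over `(0,1)`. The crux is the
specialisation `p = P(·,ϖ₀)`, `q = Q(·,ϖ₀)` (coefficients in `ℚ(ϖ₀)`); the family hypotheses are only
used at the fibre. Proof of `C⁺`:

* `stub_complexPartialFractions` — Hermite reduction over `ℚ̄ ⊂ ℂ`: `p q = R′q − Rq′ + q Σ_ρ A_ρ q/(X−ρ)`;
* `stub_realPart` — real form on `[0,1]`: `p/q = g + Σᵢ hᵢ·2(t−aᵢ)/Vᵢ + Σⱼ βⱼ b′ⱼ/V′ⱼ` (`V = (t−a)²+b²`),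
  `g = G′`, all data real algebraic, and the integrated identity
  `∫₀¹ p/q = (G 1 − G 0) + Σ hᵢ log(Vᵢ 1/Vᵢ 0) + Σ βⱼ (arctan((1−a′ⱼ)/b′ⱼ) − arctan(−a′ⱼ/b′ⱼ))`;
* `stub_bakerSplitting` — Baker (PROVED in tree: `baker_sum_eq_zero`, `baker_relation_span_int`):
  `γ = 0`, the modulus total vanishes, the angle weights are a `ℚ̄`-combination of INTEGER angle relations;
* `stub_exactModulusPart` — `[(0,1), g + Σ hᵢ Vᵢ′/Vᵢ] ∈ relations` (Newton–Leibniz over the point +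
  the proved logarithmic Newton–Leibniz rule `LogPrimitiveNL_of`);
* `stub_anglePartToArcs` — `[(0,1), Σ βⱼ b′ⱼ/V′ⱼ] ≡ Σ_k scale(c_k) Σⱼ n_kj [arcⱼ, du/(1+u²)]`
  (integrand additivity, `KZ.scale`, affine charts `u = (t − a)/b`);
* `stub_arcNormalization` — every arc is a sum of standard arcs `(0, x)`, `x ∈ (0,1)` (cuts, reflection,
  Möbius rotations) with the same total angle;
* `stub_arcScissors` — an integer combination of standard arcs of total angle `0` is a relation
  (two tilings / common refinement by Möbius rotations).
-/

noncomputable section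

open MeasureTheory Set Polynomial
open Literature.NumberTheory.Transcendental
open Literature.ModelTheory.ExponentialFields (IsSemialgebraic isSemialgebraic_univ)

namespace Summit.KontsevichZagierPeriods.InverseLandau

open Summit.KontsevichZagierPeriods.KontsevichZagierPeriods.Theses.InverseLandau (TateFamilyKernelCurves)

/-! ## Toolkit: one-dimensional representations -/

/-- The open unit cube of `ℝ¹` is the open unit interval in the coordinate `x 0`. [folklore] -/
theorem pi_univ_Ioo_eq : (Set.pi Set.univ fun _ : Fin 1 => Set.Ioo (0 : ℝ) 1) =
    {x : Fin 1 → ℝ | x 0 ∈ Set.Ioo (0 : ℝ) 1} := by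
  ext x
  simp [Fin.forall_fin_one]

/-- Set integrals over an open interval of `ℝ¹` are interval integrals. [folklore] -/
theorem setIntegral_fin_one_eq (f : ℝ → ℝ) {α α' : ℝ} (hle : α ≤ α') :
    ∫ x in {x : Fin 1 → ℝ | x 0 ∈ Set.Ioo α α'}, f (x 0) = ∫ t in α..α', f t := by
  have hmp := MeasureTheory.volume_preserving_funUnique (Fin 1) ℝ
  have hpre : {x : Fin 1 → ℝ | x 0 ∈ Set.Ioo α α'} =
      MeasurableEquiv.funUnique (Fin 1) ℝ ⁻¹' Ioo α α' := by
    ext x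
    simp [MeasurableEquiv.funUnique, Fin.default_eq_zero]
  have h1 := hmp.setIntegral_preimage_emb (MeasurableEquiv.measurableEmbedding _) f (Ioo α α')
  rw [hpre, intervalIntegral.integral_of_le hle, integral_Ioc_eq_integral_Ioo, ← h1]
  rfl

/-- Honest one-dimensional representations `[(α, α′), f]` exist for `f` continuous on `[α, α′]`
and `ℚ`-semialgebraic on `(α, α′)`, `α, α′` real algebraic. [folklore] -/
theorem exists_rep_fin_one {f : ℝ → ℝ} {α α' : ℝ} (hα : IsAlgebraic ℚ α) (hα' : IsAlgebraic ℚ α')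
    (hsa : IsSemialgebraicFunOn ℚ {x : Fin 1 → ℝ | x 0 ∈ Set.Ioo α α'} (fun x => f (x 0)))
    (hf : ContinuousOn f (Set.Icc α α')) :
    ∃ r : KZ.IntegralRep 1, r.domain = {x : Fin 1 → ℝ | x 0 ∈ Set.Ioo α α'} ∧
      r.integrand = fun x => f (x 0) :=
  ⟨⟨{x : Fin 1 → ℝ | x 0 ∈ Set.Ioo α α'}, fun x => f (x 0), as_isSemialgebraic_Ioo hα hα', hsa,
    ap_integrableOn_fin_one hf⟩, rfl, rfl⟩

/-! ## Glue -/

/-- **Transfer `C⁺`** (the ϖ-free strengthening of the crux): a real rational integrand with real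
algebraic coefficients, pole-free on `[0,1]`, with vanishing integral over `(0,1)`, is a relation.
[cite: KontsevichZagier2001, §1.2] -/
theorem algCoeffKernelDimOne (p q : Polynomial ℝ) (hp : ∀ n, IsAlgebraic ℚ (p.coeff n))
    (hq : ∀ n, IsAlgebraic ℚ (q.coeff n)) (hq0 : ∀ t ∈ Set.Icc (0 : ℝ) 1, q.eval t ≠ 0)
    (hint : ∫ t in (0 : ℝ)..1, p.eval t / q.eval t = 0)
    (r : KZ.IntegralRep 1) (hdom : r.domain = {x | x 0 ∈ Set.Ioo (0 : ℝ) 1})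
    (hr : Set.EqOn r.integrand (fun x => p.eval (x 0) / q.eval (x 0)) r.domain) :
    KZ.of r ∈ KZ.relations := by
  classical
  /- Step 1: complexify and Hermite-reduce (S1). -/
  set pC : Polynomial ℂ := p.map (algebraMap ℝ ℂ) with hpC
  set qC : Polynomial ℂ := q.map (algebraMap ℝ ℂ) with hqC
  have hq_ne : q ≠ 0 := by
    intro h0
    exact hq0 0 ⟨le_rfl, zero_le_one⟩ (by simp [h0])
  have hqC_ne : qC ≠ 0 := by
    rw [hqC, Ne, Polynomial.map_eq_zero_iff (algebraMap ℝ ℂ).injective]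
    exact hq_ne
  have hpC_alg : ∀ n, IsAlgebraic ℚ (pC.coeff n) := fun n => by
    rw [hpC, Polynomial.coeff_map]
    exact (hp n).algebraMap
  have hqC_alg : ∀ n, IsAlgebraic ℚ (qC.coeff n) := fun n => by
    rw [hqC, Polynomial.coeff_map]
    exact (hq n).algebraMap
  obtain ⟨R, A, hR, hA, hid⟩ := stub_complexPartialFractions pC qC hqC_ne hpC_alg hqC_alg
  /- Step 2: the real form on `[0,1]` and its integral (S2). -/
  obtain ⟨G, g, m₁, m₂, a, b, h, a', b', β, hGsa, hGc, hgc, hGd, hG0, hG1, halg₁, hV, halg₂, hpt, hI⟩ :=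
    stub_realPart p q R A hp hq hR hA hq0 hid
  have hVpos : ∀ i, ∀ t ∈ Set.Icc (0 : ℝ) 1, 0 < (t - a i) ^ 2 + (b i) ^ 2 := fun i t ht =>
    lt_of_le_of_ne (by positivity) (hV i t ht).symm
  have hV'pos : ∀ j (t : ℝ), 0 < (t - a' j) ^ 2 + (b' j) ^ 2 := fun j t => by
    have := (halg₂ j).2.2.2
    positivity
  /- Step 3: Baker splitting (S3). -/
  have hu_alg : ∀ i, IsAlgebraic ℚ (((1 - a i) ^ 2 + (b i) ^ 2) / ((a i) ^ 2 + (b i) ^ 2)) := fun i => by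
    obtain ⟨ha, hb, -⟩ := halg₁ i
    rw [div_eq_mul_inv]
    exact (((isAlgebraic_one.sub ha).pow 2).add (hb.pow 2)).mul ((ha.pow 2).add (hb.pow 2)).inv
  have hu_pos : ∀ i, 0 < ((1 - a i) ^ 2 + (b i) ^ 2) / ((a i) ^ 2 + (b i) ^ 2) := fun i => by
    have h1 := hVpos i 1 ⟨zero_le_one, le_rfl⟩
    have h0 := hVpos i 0 ⟨le_rfl, zero_le_one⟩
    simp only [zero_sub, even_two, Even.neg_pow] at h0
    exact div_pos h1 h0
  have hx_alg : ∀ j, IsAlgebraic ℚ ((1 - a' j) / b' j) := fun j => by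
    obtain ⟨ha, hb, -, -⟩ := halg₂ j
    rw [div_eq_mul_inv]
    exact (isAlgebraic_one.sub ha).mul hb.inv
  have hy_alg : ∀ j, IsAlgebraic ℚ (-a' j / b' j) := fun j => by
    obtain ⟨ha, hb, -, -⟩ := halg₂ j
    rw [div_eq_mul_inv]
    exact ha.neg.mul hb.inv
  have hrel : (G 1 - G 0) +
      ∑ i, h i * Real.log (((1 - a i) ^ 2 + (b i) ^ 2) / ((a i) ^ 2 + (b i) ^ 2)) +
      ∑ j, β j * (Real.arctan ((1 - a' j) / b' j) - Real.arctan (-a' j / b' j)) = 0 := by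
    rw [← hI]
    exact hint
  obtain ⟨hγ, hmod, Rk, n, c, hc, hnrel, hβ⟩ :=
    stub_bakerSplitting m₁ m₂ (G 1 - G 0) h
      (fun i => ((1 - a i) ^ 2 + (b i) ^ 2) / ((a i) ^ 2 + (b i) ^ 2)) β
      (fun j => (1 - a' j) / b' j) (fun j => -a' j / b' j) (hG1.sub hG0)
      (fun i => ⟨(halg₁ i).2.2, hu_alg i, hu_pos i⟩)
      (fun j => ⟨(halg₂ j).2.2.1, hx_alg j, hy_alg j⟩) hrel
  /- Step 4: split `r` into the exact+modulus part `r₁` and the angle part `r₂` (rule 1b). -/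
  set D : Set (Fin 1 → ℝ) := {x | x 0 ∈ Set.Ioo (0 : ℝ) 1} with hD_def
  have hD : IsSemialgebraic ℚ D := as_isSemialgebraic_Ioo isAlgebraic_zero isAlgebraic_one
  set f₁ : ℝ → ℝ := fun t => g t + ∑ i, h i * (2 * (t - a i)) / ((t - a i) ^ 2 + (b i) ^ 2)
    with hf₁
  set f₂ : ℝ → ℝ := fun t => ∑ j, β j * b' j / ((t - a' j) ^ 2 + (b' j) ^ 2) with hf₂
  have hf₂c : ContinuousOn f₂ (Set.Icc 0 1) := by
    refine continuousOn_finsetSum _ fun j _ => ?_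
    exact continuousOn_const.div (by fun_prop) fun t _ => (hV'pos j t).ne'
  have hf₁c : ContinuousOn f₁ (Set.Icc 0 1) := by
    refine hgc.add (continuousOn_finsetSum _ fun i _ => ?_)
    exact ContinuousOn.div (by fun_prop) (by fun_prop) fun t ht => hV i t ht
  have hf₂sa : IsSemialgebraicFunOn ℚ D (fun x => f₂ (x 0)) := by
    refine IsSemialgebraicFunOn.fun_finsetSum _ hD fun j _ => ?_
    obtain ⟨ha, hb, hβa, -⟩ := halg₂ j
    exact (isSemialgebraicFunOn_const_of_isAlgebraic hD (hβa.mul hb)).div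
      ((((isSemialgebraicFunOn_apply hD 0).fun_sub
        (isSemialgebraicFunOn_const_of_isAlgebraic hD ha)).fun_pow 2).fun_add
        ((isSemialgebraicFunOn_const_of_isAlgebraic hD hb).fun_pow 2))
      fun x _ => (hV'pos j (x 0)).ne'
  have hpq_sa : IsSemialgebraicFunOn ℚ D (fun x => p.eval (x 0) / q.eval (x 0)) :=
    (rp_isSemialgebraicFunOn_eval hD hp).div
      (rp_isSemialgebraicFunOn_eval hD hq) fun x hx => hq0 _ (Ioo_subset_Icc_self hx)
  have hsplit : ∀ t ∈ Set.Icc (0 : ℝ) 1, p.eval t / q.eval t = f₁ t + f₂ t := fun t ht => by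
    rw [hpt t ht]
  have hf₁sa : IsSemialgebraicFunOn ℚ D (fun x => f₁ (x 0)) :=
    (hpq_sa.fun_sub hf₂sa).congr fun x hx => by
      have := hsplit (x 0) (Ioo_subset_Icc_self hx)
      show p.eval (x 0) / q.eval (x 0) - f₂ (x 0) = f₁ (x 0)
      rw [this, add_sub_cancel_right]
  obtain ⟨r₁, hr₁d, hr₁i⟩ := exists_rep_fin_one isAlgebraic_zero isAlgebraic_one hf₁sa hf₁c
  obtain ⟨r₂, hr₂d, hr₂i⟩ := exists_rep_fin_one isAlgebraic_zero isAlgebraic_one hf₂sa hf₂c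
  have hadd : KZ.of r - KZ.of r₁ - KZ.of r₂ ∈ KZ.relations := by
    refine KZ.integrandAddRel_subset_relations ⟨1, r, r₁, r₂, by rw [hr₁d, hdom], by rw [hr₂d, hdom],
      fun x hx => ?_, rfl⟩
    have hx' : x 0 ∈ Set.Ioo (0 : ℝ) 1 := by rw [hdom] at hx; exact hx
    show r.integrand x = r₁.integrand x + r₂.integrand x
    rw [hr hx, hr₁i, hr₂i]
    exact hsplit (x 0) (Ioo_subset_Icc_self hx')
  /- Step 5: the exact+modulus part is a relation (S4). -/
  have h₁ : KZ.of r₁ ∈ KZ.relations :=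
    stub_exactModulusPart G g m₁ a b h r₁ hGsa hGc hgc hGd (sub_eq_zero.mp hγ) halg₁ hV hmod hr₁d
      (by rw [hr₁i]; exact fun x _ => rfl)
  /- Step 6: the angle part, reduced to arcs of `du/(1+u²)` (S5). -/
  have hlt : ∀ j, -a' j / b' j < (1 - a' j) / b' j := fun j =>
    div_lt_div_of_pos_right (by linarith) (halg₂ j).2.2.2
  choose ρ hρd hρi using fun j => as_exists_arcRep (hy_alg j) (hx_alg j)
  have h₅ : KZ.of r₂ - ∑ k, KZ.scale (c k) (hc k) (∑ j, n k j • KZ.of (ρ j)) ∈ KZ.relations :=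
    stub_anglePartToArcs m₂ Rk a' b' β n c hc r₂ ρ halg₂ hβ hr₂d (by rw [hr₂i]; exact fun x _ => rfl)
      fun j => ⟨hρd j, by rw [hρi j]; exact fun x _ => rfl⟩
  /- Step 7: normalise the arcs (S6) and cancel them (S7). -/
  choose K xs σ hxs hσ hsum hρσ using fun j =>
    stub_arcNormalization (-a' j / b' j) ((1 - a' j) / b' j) (hy_alg j) (hx_alg j) (hlt j) (ρ j)
      (hρd j) (by rw [hρi j]; exact fun x _ => rfl)
  have h₇ : ∀ k, ∑ j, n k j • KZ.of (ρ j) ∈ KZ.relations := by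
    intro k
    -- flatten the double family of standard arcs
    obtain ⟨N, ⟨e⟩⟩ := Finite.exists_equiv_fin (Σ j : Fin m₂, Fin (K j))
    have hsc := stub_arcScissors N (fun l => xs (e.symm l).1 (e.symm l).2) (fun l => n k (e.symm l).1)
      (fun l => σ (e.symm l).1 (e.symm l).2) (fun l => hxs _ _) ?_ (fun l => hσ _ _)
    · -- `Σ_l n_l • [σ_l] = Σ_j n_kj • Σ_i [σ_ji]`
      have e1 : ∑ l, (fun l => n k (e.symm l).1) l • KZ.of ((fun l => σ (e.symm l).1 (e.symm l).2) l) =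
          ∑ s : (Σ j : Fin m₂, Fin (K j)), n k s.1 • KZ.of (σ s.1 s.2) :=
        Fintype.sum_equiv e.symm _ (fun s : (Σ j : Fin m₂, Fin (K j)) => n k s.1 • KZ.of (σ s.1 s.2))
          fun l => rfl
      have e2 : ∑ s : (Σ j : Fin m₂, Fin (K j)), n k s.1 • KZ.of (σ s.1 s.2) =
          ∑ j, n k j • ∑ i, KZ.of (σ j i) := by
        rw [Fintype.sum_sigma' (fun j i => n k j • KZ.of (σ j i))]
        exact Finset.sum_congr rfl fun j _ => Finset.smul_sum.symm
      rw [e1, e2] at hsc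
      have e3 : ∑ j, n k j • KZ.of (ρ j) =
          ∑ j, n k j • (KZ.of (ρ j) - ∑ i, KZ.of (σ j i)) + ∑ j, n k j • ∑ i, KZ.of (σ j i) := by
        rw [← Finset.sum_add_distrib]
        exact Finset.sum_congr rfl fun j _ => by rw [← smul_add, sub_add_cancel]
      rw [e3]
      exact KZ.relations.add_mem (sum_mem fun j _ => KZ.relations.zsmul_mem (hρσ j) _) hsc
    · -- the flattened angle relation
      have e1 : ∑ l, ((fun l => n k (e.symm l).1) l : ℝ) * Real.arctan ((fun l => xs (e.symm l).1 (e.symm l).2) l) =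
          ∑ s : (Σ j : Fin m₂, Fin (K j)), (n k s.1 : ℝ) * Real.arctan (xs s.1 s.2) :=
        Fintype.sum_equiv e.symm _
          (fun s : (Σ j : Fin m₂, Fin (K j)) => (n k s.1 : ℝ) * Real.arctan (xs s.1 s.2)) fun l => rfl
      rw [e1, Fintype.sum_sigma' (fun j i => (n k j : ℝ) * Real.arctan (xs j i))]
      simp_rw [← Finset.mul_sum, hsum]
      exact hnrel k
  /- Step 8: assemble. -/
  have h₂ : KZ.of r₂ ∈ KZ.relations := by
    have hS : ∑ k, KZ.scale (c k) (hc k) (∑ j, n k j • KZ.of (ρ j)) ∈ KZ.relations :=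
      sum_mem fun k _ => KZ.scale_mem_relations (c k) (hc k) (h₇ k)
    have := KZ.relations.add_mem h₅ hS
    simpa using this
  have e : KZ.of r = (KZ.of r - KZ.of r₁ - KZ.of r₂) + KZ.of r₁ + KZ.of r₂ := by abel
  rw [e]
  exact KZ.relations.add_mem (KZ.relations.add_mem hadd h₁) h₂

/-- **The crux from the line** (`TateFamilyKernelCurves_of`): specialise the Tate family at the
algebraic fibre `ϖ₀` (`p₀ = P(X, ϖ₀)`, `q₀ = Q(X, ϖ₀) ∈ ℝ[X]`, coefficients in `ℚ(ϖ₀)`, hence real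
algebraic; admissibility at `ϖ₀` is pole-freeness on `[0,1]`; the vanishing fibre integral over the
open unit cube of `ℝ¹` is the interval integral) and apply the transfer `algCoeffKernelDimOne`.
[cite: KontsevichZagier2001, §1.2] -/
theorem TateFamilyKernelCurves_of : TateFamilyKernelCurves := by
  intro P Q ε hε hT hA hV ϖ₀ halg hϖ₀ r hdom heq
  classical
  -- the specialisation map `X₀ ↦ X`, `X₁ ↦ ϖ₀`
  set f : Fin 2 → Polynomial ℝ := Fin.snoc (fun _ : Fin 1 => Polynomial.X) (Polynomial.C ϖ₀) with hf
  set ev : MvPolynomial (Fin 2) ℚ →ₐ[ℚ] Polynomial ℝ := MvPolynomial.aeval f with hev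
  have hev_eval : ∀ (S : MvPolynomial (Fin 2) ℚ) (z : Fin 1 → ℝ),
      (ev S).eval (z 0) = MvPolynomial.aeval (Fin.snoc z ϖ₀ : Fin 2 → ℝ) S := by
    intro S z
    have h1 : ((Polynomial.aeval (z 0) : Polynomial ℝ →ₐ[ℝ] ℝ).restrictScalars ℚ).comp ev =
        MvPolynomial.aeval (Fin.snoc z ϖ₀ : Fin 2 → ℝ) := by
      rw [hev, MvPolynomial.comp_aeval]
      congr 1
      funext i
      refine Fin.lastCases ?_ (fun i => ?_) i
      · simp only [hf, Fin.snoc_last]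
        simp
      · have hi : i = 0 := Subsingleton.elim _ _
        subst hi
        simp only [hf, Fin.snoc_castSucc]
        simp
    have h2 := congrArg (fun φ : MvPolynomial (Fin 2) ℚ →ₐ[ℚ] ℝ => φ S) h1
    simpa [Polynomial.coe_aeval_eq_eval] using h2
  -- coefficients of the specialisation are real algebraic
  have hcoef : ∀ S : MvPolynomial (Fin 2) ℚ, ∀ n, IsAlgebraic ℚ ((ev S).coeff n) := by
    intro S
    induction S using MvPolynomial.induction_on with
    | C a =>
      intro n
      rw [hev, MvPolynomial.aeval_C, Polynomial.algebraMap_apply, Polynomial.coeff_C]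
      split_ifs
      · exact isAlgebraic_algebraMap _
      · exact isAlgebraic_zero
    | add p q hp hq =>
      intro n
      rw [map_add, Polynomial.coeff_add]
      exact (hp n).add (hq n)
    | mul_X p i hp =>
      intro n
      rw [map_mul, hev, MvPolynomial.aeval_X]
      refine Fin.lastCases ?_ (fun i => ?_) i
      · have : f (Fin.last 1) = Polynomial.C ϖ₀ := by simp only [hf, Fin.snoc_last]
        rw [this, Polynomial.coeff_mul_C]
        exact (hp n).mul halg
      · have hi : i = 0 := Subsingleton.elim _ _
        subst hi
        have : f (Fin.castSucc 0) = Polynomial.X := by simp only [hf, Fin.snoc_castSucc]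
        rw [this]
        cases n with
        | zero =>
          rw [Polynomial.mul_coeff_zero, Polynomial.coeff_X_zero, mul_zero]
          exact isAlgebraic_zero
        | succ n =>
          rw [Polynomial.coeff_mul_X]
          exact hp n
  -- the fibre data
  have hq0 : ∀ t ∈ Set.Icc (0 : ℝ) 1, (ev Q).eval t ≠ 0 := fun t ht => by
    have := hA (fun _ : Fin 1 => t) ϖ₀ (fun _ => ht) hϖ₀
    rwa [← hev_eval Q (fun _ : Fin 1 => t)] at this
  have hint : ∫ t in (0 : ℝ)..1, (ev P).eval t / (ev Q).eval t = 0 := by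
    have h0 := hV ϖ₀ hϖ₀
    rw [pi_univ_Ioo_eq] at h0
    have e2 : (fun z : Fin 1 → ℝ => MvPolynomial.aeval (Fin.snoc z ϖ₀ : Fin 2 → ℝ) P /
        MvPolynomial.aeval (Fin.snoc z ϖ₀ : Fin 2 → ℝ) Q) =
        fun z => (fun t => (ev P).eval t / (ev Q).eval t) (z 0) := by
      funext z
      simp only [hev_eval]
    rw [e2, setIntegral_fin_one_eq (fun t => (ev P).eval t / (ev Q).eval t) zero_le_one] at h0
    exact h0
  have hdom' : r.domain = {x | x 0 ∈ Set.Ioo (0 : ℝ) 1} := by rw [hdom, pi_univ_Ioo_eq]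
  have hr : Set.EqOn r.integrand (fun x => (ev P).eval (x 0) / (ev Q).eval (x 0)) r.domain :=
    fun x hx => by
      show r.integrand x = (ev P).eval (x 0) / (ev Q).eval (x 0)
      rw [hev_eval, hev_eval]
      exact heq hx
  exact algCoeffKernelDimOne (ev P) (ev Q) (hcoef P) (hcoef Q) hq0 hint r hdom' hr

end Summit.KontsevichZagierPeriods.InverseLandau

end
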